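import Literature.Probability.RandomPlanarGeometry.SAWStripPolygonWallBound
import Literature.Probability.RandomPlanarGeometry.SAWTubeInsertionMargin
import Literature.Probability.RandomPlanarGeometry.SAWStripPolygonLimit
import HarnessLib

/-!
# Polygons in a planar strip: the numeric deficit and Theorem 8.2.2 (a)∧(b) as printed (d = 2)

Topic `Literature/Probability/RandomPlanarGeometry` (continues `SAWStripPolygonWallBound.lean`:
`Zd.tubePolygonRate_le_tubeConnectiveConstant_pred : π(S_T) ≤ μ(S_{T-1})`,
`Zd.log_tubeConnectiveConstant_sub_log_tubePolygonRate_ge_gap`; `SAWStripPolygonStrict.lean`: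
`Zd.MadrasSlade1993_thm822b_strip`; `SAWTubeInsertionMargin.lean`: the explicit (8.2.13) margin
`TubeInsertion.log_tubeConnectiveConstant_succ_sub_log_ge`; `SAWStripPolygonLimit.lean`: `Zd.MadrasSlade1993_thm822a_strip`).
Source: N. Madras, G. Slade, *The Self-Avoiding Walk* (1993), §8.2, Theorem 8.2.2 (a),(b) (pp. 270–271) and
Theorem 8.2.1 (8.2.13) (p. 269). Proved here (`S_T = ℤ × {0,…,T}`, `π(S_T) = Zd.tubePolygonRate 2 1 T`,
`μ(S_T) = Zd.tubeConnectiveConstant 2 1 T`, all `T ≥ 1`):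
* `Zd.log_tubeConnectiveConstant_sub_log_tubePolygonRate_ge_explicit` — the fully numeric polygon deficit
  `log μ(S_T) - log π(S_T) ≥ log(1 + 3^{-4T}) / T`;
* `Zd.MadrasSlade1993_thm822ab_strip` — Theorem 8.2.2 (a) ∧ (b) as printed for planar strips: the even-length limit
  `μ_Polygon(S_T)` exists (`MadrasSlade1993_thm822a_strip`) and is `< μ(S_T)`; with the sharper `μ_Polygon(S_T) ≤ μ(S_{T-1})`.
-/

noncomputable section

open Filter Topology Literature.Probability.LatticeModels

namespace Literature.Probability.RandomPlanarGeometry.SAW.Zd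

open Real in
/-- **Numeric polygon deficit of the planar strip `S_T = ℤ × {0,…,T}`:**
`log μ(S_T) - log π(S_T) ≥ log(1 + 3^{-4T}) / T` for every `T ≥ 1` — from `π(S_T) ≤ μ(S_{T-1})`
(`tubePolygonRate_le_tubeConnectiveConstant_pred`), the explicit (8.2.13) margin
`log(1 + μ(S_T)^{-4T})/T ≤ log μ(S_T) - log μ(S_{T-1})` (`TubeInsertion.log_tubeConnectiveConstant_succ_sub_log_ge`,
two-column insertion) and `μ(S_T) ≤ μ(ℤ²) ≤ 3`.
[cite: MadrasSlade1993, Theorem 8.2.2 (b) (p. 271; explicit deficit, this file)] -/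
theorem log_tubeConnectiveConstant_sub_log_tubePolygonRate_ge_explicit {T : ℕ} (hT : 1 ≤ T) :
    Real.log (1 + (3 : ℝ) ^ (-(4 * (T : ℝ)))) / (T : ℝ) ≤
      Real.log (tubeConnectiveConstant 2 1 T) - Real.log (tubePolygonRate 2 1 T) := by
  have hT0 : (0 : ℝ) < T := by exact_mod_cast hT
  have hμ0 : 0 < tubeConnectiveConstant 2 1 T := tubeConnectiveConstant_pos (d := 2) le_rfl _
  have hμ3 : tubeConnectiveConstant 2 1 T ≤ 3 := by
    have h1 := tubeConnectiveConstant_le (d := 2) (k := 1) le_rfl T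
    have h2 := connectiveConstant_le 2 (by norm_num)
    norm_num at h2
    linarith
  -- the (8.2.13) margin at `L = T - 1`
  have hm := TubeInsertion.log_tubeConnectiveConstant_succ_sub_log_ge (d := 0) (T - 1)
  have eT : T - 1 + 1 = T := Nat.sub_add_cancel hT
  have eL : ((T - 1 : ℕ) : ℝ) = (T : ℝ) - 1 := by push_cast [Nat.cast_sub hT]; ring
  rw [eT, eL] at hm
  simp only [zero_add, pow_one] at hm
  have e1 : -(2 * ((T : ℝ) - 1 + 1) + 2 * ((T : ℝ) - 1) + 2) = -(4 * (T : ℝ)) := by ring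
  have e2 : ((T : ℝ) - 1 + 1) = T := by ring
  rw [e1, e2] at hm
  -- `3^{-4T} ≤ μ(S_T)^{-4T}`
  have h3 : (3 : ℝ) ^ (-(4 * (T : ℝ))) ≤ tubeConnectiveConstant 2 1 T ^ (-(4 * (T : ℝ))) :=
    Real.rpow_le_rpow_of_nonpos hμ0 hμ3 (by linarith)
  have h4 : Real.log (1 + (3 : ℝ) ^ (-(4 * (T : ℝ)))) ≤ Real.log (1 + tubeConnectiveConstant 2 1 T ^ (-(4 * (T : ℝ)))) :=
    Real.log_le_log (by positivity) (by linarith)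
  have h5 := log_tubeConnectiveConstant_sub_log_tubePolygonRate_ge_gap hT
  calc Real.log (1 + (3 : ℝ) ^ (-(4 * (T : ℝ)))) / (T : ℝ)
      ≤ Real.log (1 + tubeConnectiveConstant 2 1 T ^ (-(4 * (T : ℝ)))) / T := by gcongr
    _ ≤ Real.log (tubeConnectiveConstant 2 1 T) - Real.log (tubeConnectiveConstant 2 1 (T - 1)) := hm
    _ ≤ Real.log (tubeConnectiveConstant 2 1 T) - Real.log (tubePolygonRate 2 1 T) := h5

/-- **Madras–Slade Theorem 8.2.2 (a) ∧ (b) for planar strips, AS PRINTED, with the thinner-strip bound**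
(`d = 2`, `k = 1`, `T ≥ 1`): the limit `μ_Polygon(S_T) = lim_N q̃_{2N+2}(S_T)^{1/(2N+2)}` EXISTS, is STRICTLY LESS than
`μ(S_T)`, and indeed `≤ μ(S_{T-1})` — `MadrasSlade1993_thm822a_strip` (existence, `SAWStripPolygonLimit.lean`),
`MadrasSlade1993_thm822b_strip` (strictness, `SAWStripPolygonStrict.lean`), `tubePolygonRate_le_tubeConnectiveConstant_pred`
(`SAWStripPolygonWallBound.lean`). [cite: MadrasSlade1993, Theorem 8.2.2 (a),(b) (pp. 270–271)] -/
theorem MadrasSlade1993_thm822ab_strip {T : ℕ} (hT : 1 ≤ T) :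
    ∃ μP : ℝ, Tendsto (fun N : ℕ => (tubePolygonCount 2 1 T (2 * N + 2) : ℝ) ^ (1 / (2 * (N : ℝ) + 2))) atTop (𝓝 μP) ∧
      μP < tubeConnectiveConstant 2 1 T ∧ μP ≤ tubeConnectiveConstant 2 1 (T - 1) :=
  ⟨tubePolygonRate 2 1 T, MadrasSlade1993_thm822a_strip hT, MadrasSlade1993_thm822b_strip hT,
    tubePolygonRate_le_tubeConnectiveConstant_pred hT⟩

end Literature.Probability.RandomPlanarGeometry.SAW.Zd

end
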